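import Mathlib.Data.Int.GCD
import Mathlib.Data.Int.ModEq
import Mathlib.Tactic.Ring
import Mathlib.Tactic.NormNum
import Mathlib.Tactic.Linarith

/-!
HONEST FRAMING: per-curve certified theorems and census instruments; no claim on BSD in rank ≥ 2.

# KERNEL-3ISO kit F — lifting certificates for the E-side charts (cert-1 gen 10)

The E-side certificate kit (`Rank2ObservatoryThreeIsoCertE.lean`, `ThreeIso.descent_mem_of_certs`) asks, per
certificate `(p, k)`, that the three affine charts of the minimised torsor
`A X³ + B Y³ + C Z³ + D XYZ` have no zero modulo `p ^ k`, as the bounded statements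
`∀ b < p ^ k, ∀ d < p ^ k, (A + B b³ + C d³ + D (b d)) % p ^ k ≠ 0` (and the two analogues).
Deciding such a statement costs `p ^ (2k)` evaluations.  This file proves the HENSEL-STYLE LIFTING STEP
[folklore]: if every zero modulo `p ^ j` (with coordinates `< p ^ j`) is listed in an explicit list `L` (membership as
`∃ bd ∈ L, bd.1 = b ∧ bd.2 = d`, decidable with core instances), and no
member of `L` lifts to a zero modulo `p ^ (j + 1)`, then the chart has no zero modulo `p ^ (j + 1)`.
Both hypotheses are again bounded decidable statements, of total cost `p ^ (2j) + #L · p ^ 2`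
instead of `p ^ (2j + 2)`.  One lemma per chart shape (`chartE₁/₂/₃_empty_of_lift`), stated with the
literal polynomial expressions of kit E so that a row can discharge a conjunct of `hvalid` by
`exact chartE₁_empty_of_lift A B C D p j L (by decide +kernel) (by decide +kernel)`.
-/

set_option linter.dupNamespace false

namespace Summit.BirchSwinnertonDyer.BirchSwinnertonDyer.Rank2Observatory.ThreeIso

/-- The arithmetic core of the lifting step, for an arbitrary integer-valued function of two natural
arguments that respects congruences modulo `p ^ j` [folklore]. -/
theorem bounded_empty_of_lift (f : ℤ → ℤ → ℤ) (p j : ℕ) (hp : 0 < p)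
    (hf : ∀ x x' y y' : ℤ, x % ((p ^ j : ℕ) : ℤ) = x' % ((p ^ j : ℕ) : ℤ) →
      y % ((p ^ j : ℕ) : ℤ) = y' % ((p ^ j : ℕ) : ℤ) →
      f x y % ((p ^ j : ℕ) : ℤ) = f x' y' % ((p ^ j : ℕ) : ℤ))
    (L : List (ℕ × ℕ))
    (hL : ∀ b : ℕ, b < p ^ j → ∀ d : ℕ, d < p ^ j → f b d % ((p ^ j : ℕ) : ℤ) = 0 →
      ∃ bd ∈ L, bd.1 = b ∧ bd.2 = d)
    (hlift : ∀ bd ∈ L, ∀ i : ℕ, i < p → ∀ i' : ℕ, i' < p →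
      f ((bd.1 + p ^ j * i : ℕ) : ℤ) ((bd.2 + p ^ j * i' : ℕ) : ℤ) % ((p ^ (j + 1) : ℕ) : ℤ) ≠ 0) :
    ∀ b : ℕ, b < p ^ (j + 1) → ∀ d : ℕ, d < p ^ (j + 1) → f b d % ((p ^ (j + 1) : ℕ) : ℤ) ≠ 0 := by
  intro b hb d hd hzero
  have hpj : 0 < p ^ j := Nat.pow_pos hp
  -- reduce to level `j`
  have hdvd : ((p ^ j : ℕ) : ℤ) ∣ ((p ^ (j + 1) : ℕ) : ℤ) := by
    exact_mod_cast pow_dvd_pow p (Nat.le_succ j)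
  have hzero' : f b d % ((p ^ j : ℕ) : ℤ) = 0 := by
    have := Int.emod_emod_of_dvd (f b d) hdvd
    rw [hzero, Int.zero_emod] at this
    exact this.symm
  -- the reductions `b % p ^ j`, `d % p ^ j` give a listed zero
  have hbm : ((b : ℤ)) % ((p ^ j : ℕ) : ℤ) = ((b % p ^ j : ℕ) : ℤ) % ((p ^ j : ℕ) : ℤ) := by
    push_cast; simp [Int.emod_emod_of_dvd]
  have hdm : ((d : ℤ)) % ((p ^ j : ℕ) : ℤ) = ((d % p ^ j : ℕ) : ℤ) % ((p ^ j : ℕ) : ℤ) := by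
    push_cast; simp [Int.emod_emod_of_dvd]
  obtain ⟨bd, hmem, hbd1, hbd2⟩ : ∃ bd ∈ L, bd.1 = b % p ^ j ∧ bd.2 = d % p ^ j := by
    refine hL _ (Nat.mod_lt _ hpj) _ (Nat.mod_lt _ hpj) ?_
    rw [← hf _ _ _ _ hbm hdm]; exact hzero'
  -- and `(b / p ^ j, d / p ^ j)` is a lift of it
  have hi : b / p ^ j < p := by
    apply Nat.div_lt_of_lt_mul; simpa [pow_succ] using hb
  have hi' : d / p ^ j < p := by
    apply Nat.div_lt_of_lt_mul; simpa [pow_succ] using hd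
  have h1 : (b % p ^ j + p ^ j * (b / p ^ j) : ℕ) = b := Nat.mod_add_div b (p ^ j)
  have h2 : (d % p ^ j + p ^ j * (d / p ^ j) : ℕ) = d := Nat.mod_add_div d (p ^ j)
  have := hlift _ hmem _ hi _ hi'
  rw [hbd1, hbd2, h1, h2] at this
  exact this hzero

/-- Chart `X = 1` of kit E: `A + B b³ + C d³ + D (b d)` [folklore]. -/
theorem chartE₁_empty_of_lift (A B C D : ℤ) (p j : ℕ) (hp : 0 < p) (L : List (ℕ × ℕ))
    (hL : ∀ b : ℕ, b < p ^ j → ∀ d : ℕ, d < p ^ j →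
      (A + B * (b : ℤ) ^ 3 + C * (d : ℤ) ^ 3 + D * ((b : ℤ) * (d : ℤ))) % ((p ^ j : ℕ) : ℤ) = 0 →
        ∃ bd ∈ L, bd.1 = b ∧ bd.2 = d)
    (hlift : ∀ bd ∈ L, ∀ i : ℕ, i < p → ∀ i' : ℕ, i' < p →
      (A + B * ((bd.1 + p ^ j * i : ℕ) : ℤ) ^ 3 + C * ((bd.2 + p ^ j * i' : ℕ) : ℤ) ^ 3 +
        D * (((bd.1 + p ^ j * i : ℕ) : ℤ) * ((bd.2 + p ^ j * i' : ℕ) : ℤ))) % ((p ^ (j + 1) : ℕ) : ℤ) ≠ 0) :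
    ∀ b : ℕ, b < p ^ (j + 1) → ∀ d : ℕ, d < p ^ (j + 1) →
      (A + B * (b : ℤ) ^ 3 + C * (d : ℤ) ^ 3 + D * ((b : ℤ) * (d : ℤ))) % ((p ^ (j + 1) : ℕ) : ℤ) ≠ 0 :=
  bounded_empty_of_lift (fun x y => A + B * x ^ 3 + C * y ^ 3 + D * (x * y)) p j hp
    (fun x x' y y' hx hy => by
      change _ ≡ _ [ZMOD _] at hx hy ⊢
      exact ((Int.ModEq.refl A).add ((Int.ModEq.refl B).mul (hx.pow 3))).add
        ((Int.ModEq.refl C).mul (hy.pow 3)) |>.add ((Int.ModEq.refl D).mul (hx.mul hy)))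
    L hL hlift

/-- Chart `Y = 1` of kit E: `A a³ + B + C d³ + D (a d)` [folklore]. -/
theorem chartE₂_empty_of_lift (A B C D : ℤ) (p j : ℕ) (hp : 0 < p) (L : List (ℕ × ℕ))
    (hL : ∀ a : ℕ, a < p ^ j → ∀ d : ℕ, d < p ^ j →
      (A * (a : ℤ) ^ 3 + B + C * (d : ℤ) ^ 3 + D * ((a : ℤ) * (d : ℤ))) % ((p ^ j : ℕ) : ℤ) = 0 →
        ∃ ad ∈ L, ad.1 = a ∧ ad.2 = d)
    (hlift : ∀ ad ∈ L, ∀ i : ℕ, i < p → ∀ i' : ℕ, i' < p →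
      (A * ((ad.1 + p ^ j * i : ℕ) : ℤ) ^ 3 + B + C * ((ad.2 + p ^ j * i' : ℕ) : ℤ) ^ 3 +
        D * (((ad.1 + p ^ j * i : ℕ) : ℤ) * ((ad.2 + p ^ j * i' : ℕ) : ℤ))) % ((p ^ (j + 1) : ℕ) : ℤ) ≠ 0) :
    ∀ a : ℕ, a < p ^ (j + 1) → ∀ d : ℕ, d < p ^ (j + 1) →
      (A * (a : ℤ) ^ 3 + B + C * (d : ℤ) ^ 3 + D * ((a : ℤ) * (d : ℤ))) % ((p ^ (j + 1) : ℕ) : ℤ) ≠ 0 :=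
  bounded_empty_of_lift (fun x y => A * x ^ 3 + B + C * y ^ 3 + D * (x * y)) p j hp
    (fun x x' y y' hx hy => by
      change _ ≡ _ [ZMOD _] at hx hy ⊢
      exact (((Int.ModEq.refl A).mul (hx.pow 3)).add (Int.ModEq.refl B)).add
        ((Int.ModEq.refl C).mul (hy.pow 3)) |>.add ((Int.ModEq.refl D).mul (hx.mul hy)))
    L hL hlift

/-- Chart `Z = 1` of kit E: `A a³ + B b³ + C + D (a b)` [folklore]. -/
theorem chartE₃_empty_of_lift (A B C D : ℤ) (p j : ℕ) (hp : 0 < p) (L : List (ℕ × ℕ))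
    (hL : ∀ a : ℕ, a < p ^ j → ∀ b : ℕ, b < p ^ j →
      (A * (a : ℤ) ^ 3 + B * (b : ℤ) ^ 3 + C + D * ((a : ℤ) * (b : ℤ))) % ((p ^ j : ℕ) : ℤ) = 0 →
        ∃ ab ∈ L, ab.1 = a ∧ ab.2 = b)
    (hlift : ∀ ab ∈ L, ∀ i : ℕ, i < p → ∀ i' : ℕ, i' < p →
      (A * ((ab.1 + p ^ j * i : ℕ) : ℤ) ^ 3 + B * ((ab.2 + p ^ j * i' : ℕ) : ℤ) ^ 3 + C +
        D * (((ab.1 + p ^ j * i : ℕ) : ℤ) * ((ab.2 + p ^ j * i' : ℕ) : ℤ))) % ((p ^ (j + 1) : ℕ) : ℤ) ≠ 0) :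
    ∀ a : ℕ, a < p ^ (j + 1) → ∀ b : ℕ, b < p ^ (j + 1) →
      (A * (a : ℤ) ^ 3 + B * (b : ℤ) ^ 3 + C + D * ((a : ℤ) * (b : ℤ))) % ((p ^ (j + 1) : ℕ) : ℤ) ≠ 0 :=
  bounded_empty_of_lift (fun x y => A * x ^ 3 + B * y ^ 3 + C + D * (x * y)) p j hp
    (fun x x' y y' hx hy => by
      change _ ≡ _ [ZMOD _] at hx hy ⊢
      exact (((Int.ModEq.refl A).mul (hx.pow 3)).add ((Int.ModEq.refl B).mul (hy.pow 3))).add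
        (Int.ModEq.refl C) |>.add ((Int.ModEq.refl D).mul (hx.mul hy)))
    L hL hlift

/-- Smoke test of the intended use (`p = 5`, `j = 1`, chart 1 of `1 + 5 b³ + 25 d³`): the only zero
modulo 5 is… none with `b`-free constant `1`, so `L = []`. -/
example : ∀ b : ℕ, b < 5 ^ (1 + 1) → ∀ d : ℕ, d < 5 ^ (1 + 1) →
    ((1 : ℤ) + 5 * (b : ℤ) ^ 3 + 25 * (d : ℤ) ^ 3 + 0 * ((b : ℤ) * (d : ℤ))) % ((5 ^ (1 + 1) : ℕ) : ℤ) ≠ 0 :=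
  chartE₁_empty_of_lift 1 5 25 0 5 1 (by norm_num) [] (by decide +kernel) (by decide +kernel)

end Summit.BirchSwinnertonDyer.BirchSwinnertonDyer.Rank2Observatory.ThreeIso
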